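import Mathlib
import Summits.ResolutionOfSingularities.ResolutionOfSingularities.Theorems.FrobeniusLadderFRationalResolutionCharacteristicTower
import Summits.ResolutionOfSingularities.ResolutionOfSingularities.Theorems.FrobeniusLadderFRationalResolutionPointBlowupOfCompletion
import Summits.ResolutionOfSingularities.ResolutionOfSingularities.Theorems.FrobeniusLadderFRationalResolutionBlowupOrbitCentre
import Literature.AlgebraicGeometry.Resolution.BlowupsFlatBaseChange

/-!
# Crux `FrobeniusLadder.FRationalResolution` (stmt-ResolutionOfSingularities-15317), line `redirect`,
# stub `stub_diagonalizableQuotientResolution` — THE TRANSPORT STEP (T): carrying the two-step inputs `hfin` / `hloc` of a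
# blowing up `Bl_J(Spec R)` along a RING ISOMORPHISM of the base (model presentation `(T_𝔳)^` ↔ Galois presentation
# `((B ⊗_K K')_{𝔔'})^` of the complete local ring at a twisted point)

Seventh file of the (T) series. `…CompletedBaseChangeFibrePoints.hloc_stalk_of_model_charts` and
`…CompletedBaseChangeFibreFinite.finite_compl_regularLocus_of_model_charts` produce the inputs of
`…SingularPointsFinite.hloc_of_maximalIdealPow_then_finite_singularPoints` for `X₁ = Bl_{J₀Ê}(Spec Ê)` in the MODEL presentation
`Ê = (T_𝔳)^`; the consumer works with the Galois presentation `Ê' = ((B ⊗_K K')_{𝔔'})^`, isomorphic to it by the Kato chart data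
of g19/g20 (`…MonomialAlgebraCompletion`, `…FixedPointCompletionChart`). This file moves both inputs along any ring isomorphism
`e : R ≃+* S` with centre `J ↦ e(J)`:
* `exists_iso_affineBlowup_of_ringEquiv` — an isomorphism of schemes `Θ : Bl_{e(J)}(Spec S) ≅ Bl_J(Spec R)` over `Spec e`
  (uniqueness of blowing ups; the tree's `…CharacteristicTower.exists_lift_ringEquiv` is the case `R = S`);
* `mem_regularLocus_iff_of_iso`, `finite_compl_regularLocus_of_iso` — an isomorphism of schemes identifies the regular loci, so
  finiteness of the singular locus transfers;
* `isRegular_affineBlowup_maximalIdeal_stalk_of_iso` — and the regularity of `Bl_{𝔪_x}(Spec 𝒪_x)` at corresponding points;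
* ★★★ **`hfin_hloc_of_ringEquiv`** — for `e : R ≃+* S`: if `Bl_J(Spec R)` has finitely many singular points, each with
  `Bl_𝔪(Spec 𝒪)` regular, then so does `Bl_{e(J)}(Spec S)` — exactly the pair (`hfin`, `hloc`) of
  `hloc_of_maximalIdealPow_then_finite_singularPoints`, transported.

Honest label: scheme plumbing toward ONE leaf stub (no stub, crux or summit closed). No definitions, no named facts, no sorry.
[cite: GortzWedhorn2020, Prop. 13.91 (1); (13.19) p. 413] [cite: StacksProject, Tag 0804; Tag 02OS]
-/

noncomputable section

-- single-problem summit: the doubled namespace component is forced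
set_option linter.dupNamespace false

open IsLocalRing AlgebraicGeometry CategoryTheory
open Literature.AlgebraicGeometry.Resolution

namespace Summit.ResolutionOfSingularities.ResolutionOfSingularities.Theorems.FRationalResolution.CompletedBaseChangeFibreTransport

/-! ## §1 `Bl_{e(J)}(Spec S) ≅ Bl_J(Spec R)` for a ring isomorphism `e` -/

/-- `Spec e⁻¹ ≫ Spec e = 𝟙` for a ring isomorphism `e : R ≃+* S` (note `Spec` is contravariant). [folklore] -/
theorem specMap_symm_comp {R S : Type} [CommRing R] [CommRing S] (e : R ≃+* S) :
    Spec.map (CommRingCat.ofHom (e.symm : S →+* R)) ≫ Spec.map (CommRingCat.ofHom (e : R →+* S)) = 𝟙 _ := by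
  rw [← Spec.map_comp, ← CommRingCat.ofHom_comp, RingEquiv.symm_comp, CommRingCat.ofHom_id, Spec.map_id]

/-- `Spec e ≫ Spec e⁻¹ = 𝟙`. [folklore] -/
theorem specMap_comp_symm {R S : Type} [CommRing R] [CommRing S] (e : R ≃+* S) :
    Spec.map (CommRingCat.ofHom (e : R →+* S)) ≫ Spec.map (CommRingCat.ofHom (e.symm : S →+* R)) = 𝟙 _ := by
  rw [← Spec.map_comp, ← CommRingCat.ofHom_comp, RingEquiv.comp_symm, CommRingCat.ofHom_id, Spec.map_id]

/-- **`Bl_{e(J)}(Spec S) ≅ Bl_J(Spec R)` over `Spec e`** for a ring isomorphism `e : R ≃+* S` (uniqueness of blowing ups: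
`π_{e(J)} ≫ Spec e` is a blowing up of `Spec R` in `(Spec e⁻¹)⁻¹ (e J)~ = J~`). [cite: GortzWedhorn2020, Prop. 13.91 (1); (13.19) p. 413] -/
theorem exists_iso_affineBlowup_of_ringEquiv {R S : Type} [CommRing R] [CommRing S] (e : R ≃+* S) (J : Ideal R) :
    ∃ Θ : affineBlowup (J.map (e : R →+* S)) ≅ affineBlowup J,
      Θ.hom ≫ affineBlowup.π J = affineBlowup.π (J.map (e : R →+* S)) ≫ Spec.map (CommRingCat.ofHom (e : R →+* S)) := by
  -- `Spec e : Spec S ≅ Spec R`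
  let σ : Spec (.of S) ≅ Spec (.of R) :=
    ⟨Spec.map (CommRingCat.ofHom (e : R →+* S)), Spec.map (CommRingCat.ofHom (e.symm : S →+* R)),
      specMap_comp_symm e, specMap_symm_comp e⟩
  have h1 : IsBlowup (affineBlowup.π (J.map (e : R →+* S)) ≫ σ.hom)
      ((affineBlowup.idealSheaf (J.map (e : R →+* S))).comap σ.inv) :=
    (affineBlowup.isBlowup (J.map (e : R →+* S))).comp_iso σ
  have h2 : (affineBlowup.idealSheaf (J.map (e : R →+* S))).comap σ.inv = affineBlowup.idealSheaf J := by
    change (affineBlowup.idealSheaf (J.map (e : R →+* S))).comap (Spec.map (CommRingCat.ofHom (e.symm : S →+* R))) = _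
    rw [BlowupFlatCriteria.idealSheaf_comap_specMap, Ideal.map_map, RingEquiv.symm_comp, Ideal.map_id]
  rw [h2] at h1
  obtain ⟨Θ, -, hΘ⟩ := (affineBlowup.isBlowup J).unique h1
  exact ⟨Θ.symm, hΘ⟩

/-! ## §2 Regular loci and `Bl_𝔪`-regularity along an isomorphism of schemes -/

/-- An isomorphism of schemes identifies the regular loci. [folklore] -/
theorem mem_regularLocus_iff_of_iso {X Y : Scheme.{0}} (Θ : X ≅ Y) (x : X) :
    x ∈ Scheme.regularLocus X ↔ Θ.hom x ∈ Scheme.regularLocus Y :=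
  mem_regularLocus_iff_of_flat_of_isPreimmersion Θ.hom x

/-- **Finiteness of the singular locus transfers along an isomorphism of schemes.** [folklore] -/
theorem finite_compl_regularLocus_of_iso {X Y : Scheme.{0}} (Θ : X ≅ Y)
    (hfin : (Scheme.regularLocus X)ᶜ.Finite) : (Scheme.regularLocus Y)ᶜ.Finite := by
  refine Set.Finite.subset (hfin.image Θ.hom) ?_
  intro y hy
  have hyy : Θ.hom (Θ.inv y) = y := by
    rw [← Scheme.Hom.comp_apply, Θ.inv_hom_id]
    rfl
  refine ⟨Θ.inv y, ?_, hyy⟩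
  intro hreg
  apply hy
  have h := (mem_regularLocus_iff_of_iso Θ (Θ.inv y)).mp hreg
  rwa [hyy] at h

/-- **`Bl_{𝔪}`-regularity of the local rings transfers along an isomorphism of schemes.** [folklore] -/
theorem isRegular_affineBlowup_maximalIdeal_stalk_of_iso {X Y : Scheme.{0}} (Θ : X ≅ Y) (x : X)
    (h : Scheme.IsRegular (affineBlowup (maximalIdeal (X.presheaf.stalk x)))) :
    Scheme.IsRegular (affineBlowup (maximalIdeal (Y.presheaf.stalk (Θ.hom x)))) := by
  let e : Y.presheaf.stalk (Θ.hom x) ≃+* X.presheaf.stalk x := (asIso (Θ.hom.stalkMap x)).commRingCatIsoToRingEquiv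
  have h2 := BlowupOrbitCentre.isRegular_affineBlowup_map_of_ringEquiv e.symm _ h
  rwa [PointBlowupOfCompletion.map_maximalIdeal_ringEquiv e.symm] at h2

/-! ## §3 The pair (`hfin`, `hloc`) along a ring isomorphism of the base -/

/-- ★★★ **The two-step inputs transfer along a ring isomorphism of the base.** For `e : R ≃+* S` and `J ⊆ R`: if `Bl_J(Spec R)` has
finitely many singular points and `Bl_{𝔪_x}(Spec 𝒪_x)` is regular at each of them, then the same holds for `Bl_{e(J)}(Spec S)` —
the hypotheses `hfin`, `hloc` of `…SingularPointsFinite.hloc_of_maximalIdealPow_then_finite_singularPoints` move from the model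
presentation of the complete local ring to the consumer's. [cite: GortzWedhorn2020, Prop. 13.91 (1); (13.19) p. 413]
[cite: StacksProject, Tag 0804] -/
theorem hfin_hloc_of_ringEquiv {R S : Type} [CommRing R] [CommRing S] (e : R ≃+* S) (J : Ideal R)
    (hfin : (Scheme.regularLocus (affineBlowup J))ᶜ.Finite)
    (hloc : ∀ x ∈ (Scheme.regularLocus (affineBlowup J))ᶜ,
      Scheme.IsRegular (affineBlowup (maximalIdeal ((affineBlowup J).presheaf.stalk x)))) :
    (Scheme.regularLocus (affineBlowup (J.map (e : R →+* S))))ᶜ.Finite ∧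
      ∀ y ∈ (Scheme.regularLocus (affineBlowup (J.map (e : R →+* S))))ᶜ,
        Scheme.IsRegular (affineBlowup (maximalIdeal ((affineBlowup (J.map (e : R →+* S))).presheaf.stalk y))) := by
  obtain ⟨Θ, -⟩ := exists_iso_affineBlowup_of_ringEquiv e J
  -- `Θ : Bl_{e J} ≅ Bl_J`; use `Θ.symm : Bl_J ≅ Bl_{e J}`
  refine ⟨finite_compl_regularLocus_of_iso Θ.symm hfin, fun y hy => ?_⟩
  have hx : Θ.hom y ∈ (Scheme.regularLocus (affineBlowup J))ᶜ := fun hreg =>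
    hy ((mem_regularLocus_iff_of_iso Θ y).mpr hreg)
  have h := isRegular_affineBlowup_maximalIdeal_stalk_of_iso Θ.symm (Θ.hom y) (hloc _ hx)
  have hyy : Θ.symm.hom (Θ.hom y) = y := by
    change Θ.inv (Θ.hom y) = y
    rw [← Scheme.Hom.comp_apply, Θ.hom_inv_id]
    rfl
  rwa [hyy] at h

end Summit.ResolutionOfSingularities.ResolutionOfSingularities.Theorems.FRationalResolution.CompletedBaseChangeFibreTransport

end
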